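import Literature.NumberTheory.Sieve.MontgomeryVaughan1975
import HarnessLib

/-!
# Montgomery–Vaughan (1975), §3: the minor-arc mean square (3.2) from Vinogradov's estimate

This file discharges the named fact `Literature.NumberTheory.Sieve.MontgomeryVaughan1975.minorArc_meanSquare` — display
(3.2) of H. L. Montgomery, R. C. Vaughan, *The exceptional set in Goldbach's problem*, Acta Arith.
27 (1975), 353–370 [MontgomeryVaughanActa1975], p. 356:
`∑_{n ≤ X} R₂(n)² ≪ X³ P⁻¹ (log X)³⁵` — from the paper's LEMMA 3.1 in the textbook form
`Literature.NumberTheory.Sieve.MontgomeryVaughan1975.vinogradov_expSum_bound` (Nathanson, GTM 164, Theorem 8.5), following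
the printed proof (§3, pp. 355–356) step by step:

* `sum_norm_sq_setIntegral_mul_fourierChar_le` — Bessel's inequality for the characters `e(nα)`
  on a unit interval `[c, c + 1]` ("Parseval's identity implies `∑ R₂(n)² = ∫_𝔪 |S|⁴`"; only `≤`
  is needed and proved);
* `integral_norm_expSum_sq` — `∫_c^{c+1} |S(α)|² dα = ∑_{P<p≤X} log² p` ("apply Parseval's
  identity again"), and `sum_primeWindow_log_sq_le` — `∑_{P<p≤X} log² p ≤ (log 4) X log X`
  (Chebyshev, Mathlib's `Chebyshev.theta_le_log4_mul_x`);
* `exists_rat_of_mem_minorArcs` — Dirichlet's approximation theorem on `𝔪`: `α ∈ 𝔪` has a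
  reduced `a/q` with `P < q ≤ Q`, `|α - a/q| < 1/(qQ)` (§3, last paragraph);
* `norm_expSum_le_of_mem_minorArcs` — (3.3) `max_𝔪 |S| ≤ C₁ X P^{-1/2} (log X)⁴` from Lemma 3.1
  with `N = ⌊X⌋` (the primes `p ≤ P` missing from M–V's window cost `θ(P) ≤ 2 X P^{-1/2}`,
  `norm_primeExpSumLog_sub_expSum_le`); the paper's exponent `17` of the logarithm (from
  Vinogradov's original Lemma 3.1) is improved to `4` by Vaughan's form, which is harmless;
* `minorArc_meanSquare_of_vinogradov` — the assembly
  `vinogradov_expSum_bound → minorArc_meanSquare`, with `δ₀ = 1/24`, `X₀ = 4`, `C = log 4 · C₁²`.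

After this file the fact `Literature.NumberTheory.Sieve.goldbachExceptionalCount_isBigO_rpow` (parity.S15) rests on
exactly two named inputs: `vinogradov_expSum_bound` (Nathanson Thm 8.5) and
`majorArc_lowerBound` (M–V (8.3)); see `Literature.NumberTheory.Sieve.goldbachExceptionalCount_isBigO_rpow_of_mv83`.
-/

noncomputable section

open Filter Asymptotics Finset MeasureTheory
open scoped FourierTransform

namespace Literature.NumberTheory.Sieve.MontgomeryVaughan1975

/-! ### Towards (3.2): Bessel's inequality on a unit interval -/

/-- **Bessel's inequality** for the characters `e(nα)` on a unit interval, in the form needed for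
(3.2): if `s ⊆ [c, c + 1]` and `F` is continuous, then for every finite set `A` of
integers `∑_{n ∈ A} |∫_s F(α) e(-nα) dα|² ≤ ∫_s |F(α)|² dα` (Montgomery–Vaughan 1975, §3:
"Parseval's identity implies `∑_n R₂(n)² = ∫_𝔪 |S(α)|⁴ dα`"; only the inequality is used). With
`ĉ(n) = ∫_s F e(-nα)` and `g = ∑_{n ∈ A} ĉ(n) e(nα)` one has `∫_s F conj(g) = ∑ |ĉ(n)|² = T`,
`∫_c^{c+1} |g|² = T` (orthogonality), and `2 Re(F conj g) ≤ |F|² + |g|²` pointwise, whence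
`2T ≤ ∫_s |F|² + T`. [folklore] -/
theorem sum_norm_sq_setIntegral_mul_fourierChar_le {c : ℝ} {s : Set ℝ}
    (hsub : s ⊆ Set.Icc c (c + 1)) {F : ℝ → ℂ} (hF : Continuous F) (A : Finset ℤ) :
    ∑ n ∈ A, ‖∫ α in s, F α * (𝐞 (-(n * α)) : ℂ)‖ ^ 2 ≤ ∫ α in s, ‖F α‖ ^ 2 := by
  set co : ℤ → ℂ := fun n => ∫ α in s, F α * (𝐞 (-(n * α)) : ℂ) with hco
  set g : ℝ → ℂ := fun α => ∑ n ∈ A, co n * (𝐞 (n * α) : ℂ) with hg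
  set T : ℝ := ∑ n ∈ A, ‖co n‖ ^ 2 with hT
  have hgc : Continuous g := by
    simp only [hg]
    fun_prop
  -- integrability on `s` of continuous functions
  have hμs : volume s < ⊤ := (measure_mono hsub).trans_lt measure_Icc_lt_top
  have hint : ∀ {G : ℝ → ℂ}, Continuous G → IntegrableOn G s volume := fun hG =>
    (hG.continuousOn.integrableOn_compact isCompact_Icc).mono_set hsub
  have hintR : ∀ {G : ℝ → ℝ}, Continuous G → IntegrableOn G s volume := fun hG =>
    (hG.continuousOn.integrableOn_compact isCompact_Icc).mono_set hsub
  -- (1) `∫_s F conj(g) = ∑ conj(ĉ n) ĉ n = T`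
  have h1 : ∫ α in s, F α * (starRingEnd ℂ) (g α) = ∑ n ∈ A, (starRingEnd ℂ) (co n) * co n := by
    have hexp : ∀ α : ℝ, F α * (starRingEnd ℂ) (g α) =
        ∑ n ∈ A, (starRingEnd ℂ) (co n) * (F α * (𝐞 (-(n * α)) : ℂ)) := by
      intro α
      simp only [hg, map_sum, map_mul (starRingEnd ℂ), Circle.starRingEnd_addChar, Finset.mul_sum]
      refine Finset.sum_congr rfl fun n _ => ?_
      ring
    simp_rw [hexp]
    rw [integral_finsetSum _ fun n _ => ((hint (by fun_prop)).const_mul _)]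
    refine Finset.sum_congr rfl fun n _ => ?_
    exact integral_const_mul _ _
  have h1re : (∫ α in s, F α * (starRingEnd ℂ) (g α)).re = T := by
    rw [h1, hT, Complex.re_sum]
    refine Finset.sum_congr rfl fun n _ => ?_
    rw [Complex.conj_mul']
    norm_cast
  -- (2) `∫_c^{c+1} |g|² = T`
  have h2c : ∫ α in c..c + 1, (g α * (starRingEnd ℂ) (g α)) =
      ∑ n ∈ A, co n * (starRingEnd ℂ) (co n) := by
    have hexp : ∀ α : ℝ, g α * (starRingEnd ℂ) (g α) =
        ∑ m ∈ A, ∑ n ∈ A, co m * (starRingEnd ℂ) (co n) * (𝐞 (((m - n : ℤ)) * α) : ℂ) := by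
      intro α
      simp only [hg, map_sum, Finset.sum_mul_sum]
      refine Finset.sum_congr rfl fun m _ => Finset.sum_congr rfl fun n _ => ?_
      have : (𝐞 (((m - n : ℤ)) * α) : ℂ) = (𝐞 (m * α) : ℂ) * (𝐞 (-(n * α)) : ℂ) := by
        rw [← Circle.coe_mul, ← AddChar.map_add_eq_mul]
        congr 2
        push_cast
        ring
      rw [this, map_mul (starRingEnd ℂ), Circle.starRingEnd_addChar]
      ring
    simp_rw [hexp]
    rw [intervalIntegral.integral_finsetSum fun m _ =>
      Continuous.intervalIntegrable (by fun_prop) _ _]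
    rw [Finset.sum_congr rfl fun m _ => intervalIntegral.integral_finsetSum fun n _ =>
      Continuous.intervalIntegrable (by fun_prop) _ _]
    simp_rw [intervalIntegral.integral_const_mul, integral_fourierChar_intCast_unitInterval,
      sub_eq_zero, mul_ite, mul_one, mul_zero]
    refine Finset.sum_congr rfl fun m hm => ?_
    rw [Finset.sum_ite_eq]
    rw [if_pos hm]
  have h2 : ∫ α in c..c + 1, ‖g α‖ ^ 2 = T := by
    have h := h2c
    simp_rw [Complex.mul_conj'] at h
    apply Complex.ofReal_injective
    rw [← intervalIntegral.integral_ofReal, hT, Complex.ofReal_sum]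
    push_cast
    exact h
  -- (3) pointwise `2 Re (F conj g) ≤ |F|² + |g|²`
  have h3 : ∀ α : ℝ, 2 * (F α * (starRingEnd ℂ) (g α)).re ≤ ‖F α‖ ^ 2 + ‖g α‖ ^ 2 := by
    intro α
    have h := Complex.re_le_norm (F α * (starRingEnd ℂ) (g α))
    rw [norm_mul, Complex.norm_conj] at h
    nlinarith [two_mul_le_add_sq ‖F α‖ ‖g α‖]
  -- (4) integrate (3) over `s`
  have hFg : IntegrableOn (fun α => F α * (starRingEnd ℂ) (g α)) s volume := hint (by fun_prop)
  have h4 : 2 * T ≤ (∫ α in s, ‖F α‖ ^ 2) + ∫ α in s, ‖g α‖ ^ 2 := by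
    have hl : ∫ α in s, 2 * (F α * (starRingEnd ℂ) (g α)).re = 2 * T := by
      rw [integral_const_mul, ← h1re]
      congr 1
      have := integral_re hFg
      simpa using this
    have hr : ∫ α in s, (‖F α‖ ^ 2 + ‖g α‖ ^ 2) = (∫ α in s, ‖F α‖ ^ 2) + ∫ α in s, ‖g α‖ ^ 2 :=
      integral_add (hintR (by fun_prop)) (hintR (by fun_prop))
    rw [← hl, ← hr]
    refine integral_mono ?_ ((hintR (by fun_prop)).add (hintR (by fun_prop))) h3
    exact (hFg.re.const_mul 2)
  -- (5) `∫_s |g|² ≤ ∫_c^{c+1} |g|² = T`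
  have h5 : ∫ α in s, ‖g α‖ ^ 2 ≤ T := by
    rw [← h2, intervalIntegral.integral_of_le (by linarith)]
    refine setIntegral_mono_set ?_ ?_ ?_
    · exact (Continuous.integrableOn_Icc (by fun_prop)).mono_set Set.Ioc_subset_Icc_self
    · exact Filter.Eventually.of_forall fun α => sq_nonneg _
    · exact (show s ≤ Set.Icc c (c + 1) from hsub).eventuallyLE.trans Ioc_ae_eq_Icc.symm.le
  linarith

/-! ### Towards (3.2): Parseval for `S(α)` and Chebyshev's bound -/

/-- Parseval for the trigonometric polynomial `S(α)`:
`∫_c^{c+1} |S(α)|² dα = ∑_{P < p ≤ X} (log p)²` (Montgomery–Vaughan 1975, §3, display after (3.2):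
"apply Parseval's identity again to find that `∫ |S(α)|² dα = ∑_{P<p≤X} log² p`").
[cite: MontgomeryVaughanActa1975, §3 (3.2)] -/
theorem integral_norm_expSum_sq (P X c : ℝ) :
    ∫ α in c..c + 1, ‖expSum P X α‖ ^ 2 = ∑ p ∈ primeWindow P X, Real.log p ^ 2 := by
  set A := primeWindow P X with hA
  have hexp : ∀ α : ℝ, expSum P X α * (starRingEnd ℂ) (expSum P X α) =
      ∑ p₁ ∈ A, ∑ p₂ ∈ A, (Real.log p₁ : ℂ) * Real.log p₂ * (𝐞 (((p₁ - p₂ : ℤ)) * α) : ℂ) := by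
    intro α
    rw [expSum, ← hA, map_sum, Finset.sum_mul_sum]
    refine Finset.sum_congr rfl fun p₁ _ => Finset.sum_congr rfl fun p₂ _ => ?_
    have : (𝐞 (((p₁ - p₂ : ℤ)) * α) : ℂ) = (𝐞 (p₁ * α) : ℂ) * (𝐞 (-(p₂ * α)) : ℂ) := by
      rw [← Circle.coe_mul, ← AddChar.map_add_eq_mul]
      congr 2
      push_cast
      ring
    rw [this, map_mul (starRingEnd ℂ), Circle.starRingEnd_addChar, Complex.conj_ofReal]
    ring
  have h : ∫ α in c..c + 1, expSum P X α * (starRingEnd ℂ) (expSum P X α) =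
      ∑ p ∈ A, (Real.log p : ℂ) * Real.log p := by
    simp_rw [hexp]
    rw [intervalIntegral.integral_finsetSum fun m _ =>
      Continuous.intervalIntegrable (by fun_prop) _ _]
    rw [Finset.sum_congr rfl fun m _ => intervalIntegral.integral_finsetSum fun n _ =>
      Continuous.intervalIntegrable (by fun_prop) _ _]
    simp_rw [intervalIntegral.integral_const_mul, integral_fourierChar_intCast_unitInterval,
      sub_eq_zero, Nat.cast_inj, mul_ite, mul_one, mul_zero]
    refine Finset.sum_congr rfl fun m hm => ?_
    rw [Finset.sum_ite_eq]
    rw [if_pos hm]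
  simp_rw [Complex.mul_conj'] at h
  apply Complex.ofReal_injective
  rw [← intervalIntegral.integral_ofReal, Complex.ofReal_sum]
  simp only [sq, Complex.ofReal_mul] at h ⊢
  exact h

/-- `∑_{P < p ≤ X} (log p)² ≤ (log X) θ(X) ≤ (log 4) X log X` for `X ≥ 1` (Chebyshev's bound
`θ(x) ≤ x log 4`, Mathlib's `Chebyshev.theta_le_log4_mul_x`; Montgomery–Vaughan 1975, §3, use
`∑_{P<p≤X} log² p ≪ X log X`). [cite: MontgomeryVaughanActa1975, §3 (3.2)] -/
theorem sum_primeWindow_log_sq_le {P X : ℝ} (hX : 1 ≤ X) :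
    ∑ p ∈ primeWindow P X, Real.log p ^ 2 ≤ Real.log 4 * X * Real.log X := by
  have hX0 : 0 ≤ X := by linarith
  have h1 : ∑ p ∈ primeWindow P X, Real.log p ^ 2 ≤
      ∑ p ∈ Nat.primesLE ⌊X⌋₊, Real.log p * Real.log X := by
    refine (Finset.sum_le_sum_of_subset_of_nonneg (Finset.filter_subset _ _)
      fun p _ _ => sq_nonneg _).trans (Finset.sum_le_sum fun p hp => ?_)
    have hp := (Nat.mem_primesLE.mp hp)
    have hp1 : (1 : ℝ) ≤ p := by exact_mod_cast hp.2.one_lt.le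
    have hpX : (p : ℝ) ≤ X := (Nat.cast_le.mpr hp.1).trans (Nat.floor_le hX0)
    rw [sq]
    exact mul_le_mul_of_nonneg_left (Real.log_le_log (by linarith) hpX) (Real.log_nonneg hp1)
  rw [← Finset.sum_mul, ← Chebyshev.theta_eq_sum_primesLE] at h1
  calc ∑ p ∈ primeWindow P X, Real.log p ^ 2 ≤ Chebyshev.theta X * Real.log X := h1
    _ ≤ Real.log 4 * X * Real.log X :=
        mul_le_mul_of_nonneg_right (Chebyshev.theta_le_log4_mul_x hX0) (Real.log_nonneg hX)


/-! ### Towards (3.2): the minor-arc bound (3.3) from Lemma 3.1 -/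

/-- Dirichlet's approximation theorem on the minor arcs (Montgomery–Vaughan 1975, §3, last
paragraph): if `1 ≤ P`, `P + 1 ≤ Q` and `α ∈ 𝔪`, there are coprime `a`, `q` with `P < q ≤ Q` and
`|α - a/q| < 1/(qQ)` ("By Dirichlet's theorem … there exist `q ≤ Q` and `a`, `(a, q) = 1`, such that
`|α - a/q| ≤ q⁻¹ Q⁻¹`. This would imply that `α ∈ 𝔐(q, a) ⊆ 𝔐` if it were the case that `q ≤ P`.
Thus `q > P`"). [cite: MontgomeryVaughanActa1975, §3 (3.3)] -/
theorem exists_rat_of_mem_minorArcs {P Q α : ℝ} (hP : 1 ≤ P) (hPQ : P + 1 ≤ Q)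
    (hα : α ∈ minorArcs P Q) :
    ∃ a : ℤ, ∃ q : ℕ, 1 ≤ q ∧ P < q ∧ (q : ℝ) ≤ Q ∧ IsCoprime a (q : ℤ) ∧
      |α - a / q| < 1 / (q * Q) := by
  have hQ1 : 1 ≤ Q := by linarith
  have hQ0 : 0 < Q := by linarith
  obtain ⟨hαI, hαM⟩ := hα
  have hn : 0 < ⌊Q⌋₊ := Nat.floor_pos.mpr hQ1
  obtain ⟨r, hr, hden⟩ := Real.exists_rat_abs_sub_le_and_den_le α hn
  set a : ℤ := r.num with ha
  set q : ℕ := r.den with hq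
  have hq1 : 1 ≤ q := r.den_pos
  have hq0 : (0 : ℝ) < q := by exact_mod_cast r.den_pos
  have hqQ : (q : ℝ) ≤ Q := (Nat.cast_le.mpr hden).trans (Nat.floor_le hQ0.le)
  have hcop : IsCoprime a (q : ℤ) := by
    rw [Int.isCoprime_iff_gcd_eq_one, Int.gcd_eq_natAbs, Int.natAbs_natCast]
    exact r.reduced
  have hrq : (r : ℝ) = a / q := by rw [ha, hq, Rat.cast_def]
  have hlt : |α - a / q| < 1 / (q * Q) := by
    rw [← hrq]
    refine hr.trans_lt ?_
    rw [one_div_lt_one_div (by positivity) (by positivity)]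
    nlinarith [Nat.lt_floor_add_one Q]
  refine ⟨a, q, hq1, ?_, hqQ, hcop, hlt⟩
  -- `q ≤ P` would put `α` on the major arc `𝔐(q, a)`
  by_contra hqP
  push Not at hqP
  have hlt' := abs_sub_lt_iff.mp hlt
  have hqQ0 : (0 : ℝ) < q * Q := by positivity
  -- `1 ≤ a`
  have ha1 : 1 ≤ a := by
    have h1 : (a : ℝ) / q > Q⁻¹ - 1 / (q * Q) := by linarith [hαI.1, hlt'.1]
    have h2 : Q⁻¹ - 1 / (q * Q) = (q - 1) / (q * Q) := by field_simp
    have h3 : (0 : ℝ) ≤ (q - 1) / (q * Q) :=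
      div_nonneg (by linarith [show (1 : ℝ) ≤ q from by exact_mod_cast hq1]) hqQ0.le
    have h4 : (0 : ℝ) < (a : ℝ) / q := by linarith
    have h5 : (0 : ℝ) < a := (div_pos_iff_of_pos_right hq0).mp h4
    exact_mod_cast (show (0 : ℤ) < a from by exact_mod_cast h5)
  -- `a ≤ q`
  have haq : a ≤ q := by
    have h1 : (a : ℝ) / q < 1 + Q⁻¹ + 1 / (q * Q) := by linarith [hαI.2, hlt'.2]
    have h2 : (a : ℝ) < q + (q + 1) / Q := by
      have := (div_lt_iff₀ hq0).mp h1
      have h3 : (1 + Q⁻¹ + 1 / (q * Q)) * q = q + (q + 1) / Q := by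
        field_simp
        ring
      linarith
    have h3 : ((q : ℝ) + 1) / Q ≤ 1 := by
      rw [div_le_one hQ0]; linarith
    have h4 : (a : ℝ) < q + 1 := by linarith
    exact_mod_cast (show a < (q : ℤ) + 1 from by exact_mod_cast h4) |> Int.lt_add_one_iff.mp
  -- hence `α ∈ 𝔐(q, a)` and `α ∈ 𝔐`
  apply hαM
  have ha0 : 0 ≤ a := by omega
  have hcast : ((a.natAbs : ℕ) : ℝ) = a := by
    rw [Nat.cast_natAbs, abs_of_nonneg (by exact_mod_cast ha0)]
  simp only [majorArcs, Set.mem_iUnion, Finset.mem_Icc, Finset.mem_filter, exists_prop]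
  refine ⟨q, ⟨hq1, Nat.le_floor hqP⟩, a.natAbs, ⟨⟨?_, ?_⟩, r.reduced⟩, ?_, ?_⟩
  · omega
  · omega
  · rw [hcast]; linarith [hlt'.2]
  · rw [hcast]; linarith [hlt'.1]


/-- `S(α)` differs from the full sum `F_N(α) = ∑_{p ≤ N} (log p) e(pα)` (`Literature.NumberTheory.Sieve.primeExpSumLog`,
`N = ⌊X⌋`) by the primes `p ≤ P`, whose contribution is at most `θ(P)` in absolute value.
[folklore] -/
theorem norm_primeExpSumLog_sub_expSum_le (P X α : ℝ) :
    ‖Literature.NumberTheory.Sieve.primeExpSumLog ⌊X⌋₊ α - expSum P X α‖ ≤ Chebyshev.theta P := by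
  have hsplit := Finset.sum_filter_add_sum_filter_not (Nat.primesLE ⌊X⌋₊) (fun p : ℕ => P < p)
    (fun p : ℕ => (Real.log p : ℂ) * (𝐞 (p * α) : ℂ))
  have hdiff : Literature.NumberTheory.Sieve.primeExpSumLog ⌊X⌋₊ α - expSum P X α =
      ∑ p ∈ (Nat.primesLE ⌊X⌋₊).filter (fun p : ℕ => ¬ P < p),
        (Real.log p : ℂ) * (𝐞 (p * α) : ℂ) := by
    rw [Literature.NumberTheory.Sieve.primeExpSumLog, expSum, primeWindow, ← hsplit]
    ring
  rw [hdiff, Chebyshev.theta_eq_sum_primesLE]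
  refine (norm_sum_le _ _).trans ?_
  have hterm : ∀ p ∈ (Nat.primesLE ⌊X⌋₊).filter (fun p : ℕ => ¬ P < p),
      ‖(Real.log p : ℂ) * (𝐞 (p * α) : ℂ)‖ = Real.log p := by
    intro p _
    rw [norm_mul, Circle.norm_coe, mul_one, Complex.norm_real,
      Real.norm_of_nonneg (Real.log_natCast_nonneg p)]
  rw [Finset.sum_congr rfl hterm]
  refine Finset.sum_le_sum_of_subset_of_nonneg (fun p hp => ?_) fun p _ _ =>
    Real.log_natCast_nonneg p
  rw [Finset.mem_filter, not_lt] at hp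
  rw [Nat.mem_primesLE] at hp ⊢
  exact ⟨Nat.le_floor hp.2, hp.1.2⟩

/-- **(3.3)** (Montgomery–Vaughan 1975, p. 356) from Lemma 3.1 in the form
`vinogradov_expSum_bound`: with `P = X^{6δ}`, `Q = X^{1-6δ}`, `0 < δ ≤ 1/24` and `X ≥ 4`,
`max_𝔪 |S(α)| ≤ C₁ X P^{-1/2} (log X)⁴` with an absolute constant `C₁` (the paper records the
weaker exponent `17` of the logarithm coming from Vinogradov's original form of Lemma 3.1).
Proof: for `α ∈ 𝔪` Dirichlet's theorem (`exists_rat_of_mem_minorArcs`) gives `(a, q) = 1`,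
`P < q ≤ Q`, `|α - a/q| ≤ q⁻²`; Lemma 3.1 with `N = ⌊X⌋` bounds the full sum by
`C (N q^{-1/2} + N^{4/5} + N^{1/2} q^{1/2}) (log N)⁴ ≤ 3C X P^{-1/2} (log X)⁴`, and the primes
`p ≤ P` contribute at most `θ(P) ≤ P log 4 ≤ 2 X P^{-1/2}`.
[cite: MontgomeryVaughanActa1975, §3 (3.3)] -/
theorem norm_expSum_le_of_mem_minorArcs (hV : vinogradov_expSum_bound) :
    ∃ C₁ : ℝ, 0 ≤ C₁ ∧ ∀ δ : ℝ, 0 < δ → δ ≤ 1 / 24 → ∀ X : ℝ, 4 ≤ X →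
      ∀ α ∈ minorArcs (X ^ (6 * δ)) (X ^ (1 - 6 * δ)),
        ‖expSum (X ^ (6 * δ)) X α‖ ≤ C₁ * X * (X ^ (6 * δ)) ^ (-(1 / 2 : ℝ)) * Real.log X ^ 4 := by
  obtain ⟨C, hC⟩ := hV
  set C₀ : ℝ := max C 0 with hC₀
  have hC₀0 : 0 ≤ C₀ := le_max_right _ _
  refine ⟨3 * C₀ + 2, by positivity, fun δ hδ hδ24 X hX α hα => ?_⟩
  have hX0 : 0 < X := by linarith
  have hX1 : 1 ≤ X := by linarith
  set P : ℝ := X ^ (6 * δ) with hP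
  set Q : ℝ := X ^ (1 - 6 * δ) with hQ
  have hP1 : 1 ≤ P := Real.one_le_rpow hX1 (by linarith)
  have hP0 : 0 < P := by linarith
  have hPQ : P + 1 ≤ Q := rpow_add_one_le_rpow_one_sub hX (by linarith) (by linarith)
  have hQX : Q ≤ X := by
    calc Q = X ^ (1 - 6 * δ) := rfl
      _ ≤ X ^ (1 : ℝ) := Real.rpow_le_rpow_of_exponent_le hX1 (by linarith)
      _ = X := Real.rpow_one X
  -- the key quantity `X P^{-1/2} = X^{1-3δ}`
  set u : ℝ := P ^ (-(1 / 2 : ℝ)) with hu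
  have hu0 : 0 < u := Real.rpow_pos_of_pos hP0 _
  have hsqrtP : Real.sqrt P = X ^ (3 * δ) := by
    rw [Real.sqrt_eq_rpow, hP, ← Real.rpow_mul hX0.le]; ring_nf
  have hXu : X * u = X ^ (1 - 3 * δ) := by
    rw [hu, hP, ← Real.rpow_mul hX0.le, show 6 * δ * -(1 / 2 : ℝ) = -(3 * δ) by ring,
      sub_eq_add_neg, Real.rpow_add hX0, Real.rpow_one]
  have hXu' : X / Real.sqrt P = X * u := by
    rw [hu, div_eq_mul_inv, Real.sqrt_eq_rpow, ← Real.rpow_neg hP0.le]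
  -- `N = ⌊X⌋`
  set N : ℕ := ⌊X⌋₊ with hN
  have hN2 : 2 ≤ N := Nat.le_floor (by norm_num; linarith)
  have hNX : (N : ℝ) ≤ X := Nat.floor_le hX0.le
  have hN1 : (1 : ℝ) ≤ N := by exact_mod_cast (show 1 ≤ N by omega)
  have hlogN : Real.log N ≤ Real.log X := Real.log_le_log (by linarith) hNX
  have hlogN0 : 0 ≤ Real.log N := Real.log_nonneg hN1
  have hlogX1 : 1 ≤ Real.log X := by
    rw [Real.le_log_iff_exp_le hX0]
    have := Real.exp_one_lt_d9
    linarith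
  -- Dirichlet on the minor arcs
  obtain ⟨a, q, hq1, hPq, hqQ, hcop, hαq⟩ := exists_rat_of_mem_minorArcs hP1 hPQ hα
  have hq0 : (0 : ℝ) < q := by exact_mod_cast hq1
  have hqN : q ≤ N := Nat.le_floor (hqQ.trans hQX)
  have hαq' : |α - a / q| ≤ 1 / (q : ℝ) ^ 2 := by
    refine hαq.le.trans ?_
    rw [sq]
    exact one_div_le_one_div_of_le (mul_pos hq0 hq0) (mul_le_mul_of_nonneg_left hqQ hq0.le)
  -- Lemma 3.1 for the full sum
  have hF := hC N hN2 α a q hq1 hqN hcop hαq'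
  have hbr : (N : ℝ) / Real.sqrt q + (N : ℝ) ^ (4 / 5 : ℝ) + Real.sqrt N * Real.sqrt q ≤
      3 * (X * u) := by
    have h1 : (N : ℝ) / Real.sqrt q ≤ X * u := by
      rw [← hXu']
      have hsq : Real.sqrt P ≤ Real.sqrt q := Real.sqrt_le_sqrt hPq.le
      have hsqP : 0 < Real.sqrt P := Real.sqrt_pos.mpr hP0
      calc (N : ℝ) / Real.sqrt q ≤ N / Real.sqrt P :=
            div_le_div_of_nonneg_left (by linarith) hsqP hsq
        _ ≤ X / Real.sqrt P := div_le_div_of_nonneg_right hNX hsqP.le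
    have h2 : (N : ℝ) ^ (4 / 5 : ℝ) ≤ X * u := by
      rw [hXu]
      calc (N : ℝ) ^ (4 / 5 : ℝ) ≤ X ^ (4 / 5 : ℝ) :=
            Real.rpow_le_rpow (by linarith) hNX (by norm_num)
        _ ≤ X ^ (1 - 3 * δ) := Real.rpow_le_rpow_of_exponent_le hX1 (by linarith)
    have h3 : Real.sqrt N * Real.sqrt q ≤ X * u := by
      rw [hXu]
      calc Real.sqrt N * Real.sqrt q ≤ Real.sqrt X * Real.sqrt Q :=
            mul_le_mul (Real.sqrt_le_sqrt hNX) (Real.sqrt_le_sqrt hqQ) (Real.sqrt_nonneg _)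
              (Real.sqrt_nonneg _)
        _ = X ^ (1 - 3 * δ) := by
            rw [Real.sqrt_eq_rpow, Real.sqrt_eq_rpow, hQ, ← Real.rpow_mul hX0.le,
              ← Real.rpow_add hX0]
            ring_nf
    linarith
  have hFN : ‖Literature.NumberTheory.Sieve.primeExpSumLog N α‖ ≤ 3 * C₀ * (X * u) * Real.log X ^ 4 := by
    have hlog4 : Real.log N ^ 4 ≤ Real.log X ^ 4 := pow_le_pow_left₀ hlogN0 hlogN 4
    have hbr0 : 0 ≤ (N : ℝ) / Real.sqrt q + (N : ℝ) ^ (4 / 5 : ℝ) + Real.sqrt N * Real.sqrt q := by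
      positivity
    calc ‖Literature.NumberTheory.Sieve.primeExpSumLog N α‖
        ≤ C * ((N : ℝ) / Real.sqrt q + (N : ℝ) ^ (4 / 5 : ℝ) + Real.sqrt N * Real.sqrt q) *
            Real.log N ^ 4 := hF
      _ ≤ C₀ * ((N : ℝ) / Real.sqrt q + (N : ℝ) ^ (4 / 5 : ℝ) + Real.sqrt N * Real.sqrt q) *
            Real.log N ^ 4 := by gcongr; exact le_max_left _ _
      _ ≤ C₀ * (3 * (X * u)) * Real.log X ^ 4 := by gcongr
      _ = 3 * C₀ * (X * u) * Real.log X ^ 4 := by ring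
  -- the primes `p ≤ P`
  have hsmall : ‖Literature.NumberTheory.Sieve.primeExpSumLog N α - expSum P X α‖ ≤ 2 * (X * u) * Real.log X ^ 4 := by
    have hθ : Chebyshev.theta P ≤ 2 * P := by
      have hl4 : Real.log 4 ≤ 2 := by
        rw [show (4 : ℝ) = 2 ^ 2 by norm_num, Real.log_pow]
        have := Real.log_two_lt_d9
        norm_num at this ⊢
        linarith
      calc Chebyshev.theta P ≤ Real.log 4 * P := Chebyshev.theta_le_log4_mul_x hP0.le
        _ ≤ 2 * P := mul_le_mul_of_nonneg_right hl4 hP0.le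
    have hPu : P ≤ X * u := by
      -- `P = X^{6δ} ≤ X^{1-3δ}` as `9δ ≤ 1`
      rw [hXu, hP]
      exact Real.rpow_le_rpow_of_exponent_le hX1 (by linarith)
    calc ‖Literature.NumberTheory.Sieve.primeExpSumLog N α - expSum P X α‖ ≤ Chebyshev.theta P :=
          norm_primeExpSumLog_sub_expSum_le P X α
      _ ≤ 2 * (X * u) := hθ.trans (by linarith)
      _ = 2 * (X * u) * 1 := (mul_one _).symm
      _ ≤ 2 * (X * u) * Real.log X ^ 4 := by
          gcongr
          exact one_le_pow₀ hlogX1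
  calc ‖expSum P X α‖
      = ‖Literature.NumberTheory.Sieve.primeExpSumLog N α - (Literature.NumberTheory.Sieve.primeExpSumLog N α - expSum P X α)‖ := by
        rw [sub_sub_cancel]
    _ ≤ ‖Literature.NumberTheory.Sieve.primeExpSumLog N α‖ + ‖Literature.NumberTheory.Sieve.primeExpSumLog N α - expSum P X α‖ := norm_sub_le _ _
    _ ≤ 3 * C₀ * (X * u) * Real.log X ^ 4 + 2 * (X * u) * Real.log X ^ 4 := add_le_add hFN hsmall
    _ = (3 * C₀ + 2) * X * u * Real.log X ^ 4 := by ring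


/-- The minor arcs form a measurable set. [folklore] -/
theorem measurableSet_minorArcs (P Q : ℝ) : MeasurableSet (minorArcs P Q) :=
  measurableSet_Icc.diff (measurableSet_majorArcs P Q)

/-- `S(α)` is continuous (a trigonometric polynomial). [folklore] -/
@[fun_prop]
theorem continuous_expSum (P X : ℝ) : Continuous (expSum P X) := by
  unfold expSum
  fun_prop

/-- **Discharge of (3.2) from Lemma 3.1** (Montgomery–Vaughan 1975, §3, p. 356):
`vinogradov_expSum_bound → minorArc_meanSquare`, with `δ₀ = 1/24`, `X₀ = 4` and an absolute
constant. Printed proof, followed verbatim: Bessel's inequality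
(`sum_norm_sq_setIntegral_mul_fourierChar_le`) gives `∑_{n ≤ X} |R₂(n)|² ≤ ∫_𝔪 |S|⁴ ≤
(max_𝔪 |S|)² ∫_{Q⁻¹}^{1+Q⁻¹} |S|² = (max_𝔪 |S|)² ∑_{P<p≤X} log² p ≤ (max_𝔪 |S|)² X log X log 4`
(`integral_norm_expSum_sq`, `sum_primeWindow_log_sq_le`), and (3.3)
(`norm_expSum_le_of_mem_minorArcs`) bounds `max_𝔪 |S| ≤ C₁ X P^{-1/2} (log X)⁴`; altogether
`≤ log 4 · C₁² X³ P⁻¹ (log X)⁹ ≤ log 4 · C₁² X³ P⁻¹ (log X)³⁵`.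
[cite: MontgomeryVaughanActa1975, §3 (3.2)] -/
theorem minorArc_meanSquare_of_vinogradov (hV : vinogradov_expSum_bound) :
    minorArc_meanSquare := by
  obtain ⟨C₁, hC₁, hsup⟩ := norm_expSum_le_of_mem_minorArcs hV
  refine ⟨1 / 24, by norm_num, Real.log 4 * C₁ ^ 2, fun δ hδ hδ24 => ⟨4, fun X hX => ?_⟩⟩
  have hX0 : 0 < X := by linarith
  have hX1 : 1 ≤ X := by linarith
  set P : ℝ := X ^ (6 * δ) with hP
  set Q : ℝ := X ^ (1 - 6 * δ) with hQ
  have hP0 : 0 < P := Real.rpow_pos_of_pos hX0 _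
  have hQ0 : 0 < Q := Real.rpow_pos_of_pos hX0 _
  have hPQ : P + 1 ≤ Q := rpow_add_one_le_rpow_one_sub hX (by linarith) (by linarith)
  have hlogX1 : 1 ≤ Real.log X := by
    rw [Real.le_log_iff_exp_le hX0]
    have := Real.exp_one_lt_d9
    linarith
  have hl4 : 0 ≤ Real.log 4 := Real.log_nonneg (by norm_num)
  set u : ℝ := P ^ (-(1 / 2 : ℝ)) with hu
  have hu0 : 0 < u := Real.rpow_pos_of_pos hP0 _
  have hPu : P⁻¹ = u ^ 2 := by
    rw [hu, ← Real.rpow_natCast, ← Real.rpow_mul hP0.le]; norm_num [Real.rpow_neg_one]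
  set M : ℝ := C₁ * X * u * Real.log X ^ 4 with hM
  have hM0 : 0 ≤ M := by positivity
  have hSle : ∀ α ∈ minorArcs P Q, ‖expSum P X α‖ ≤ M := fun α hα => hsup δ hδ hδ24 X hX α hα
  -- Bessel on `𝔪 ⊆ [Q⁻¹, Q⁻¹ + 1]` with `F = S²`
  have hsub : minorArcs P Q ⊆ Set.Icc Q⁻¹ (Q⁻¹ + 1) := by
    rw [add_comm]; exact fun α hα => hα.1
  have hcont : Continuous fun α : ℝ => expSum P X α ^ 2 := by fun_prop
  have hB := sum_norm_sq_setIntegral_mul_fourierChar_le hsub hcont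
    ((Finset.Icc 1 ⌊X⌋₊).map Nat.castEmbedding)
  rw [Finset.sum_map] at hB
  simp only [Nat.castEmbedding_apply, Int.cast_natCast] at hB
  -- `∫_𝔪 |S|⁴ ≤ M² ∫_𝔪 |S|² ≤ M² ∫_{Q⁻¹}^{Q⁻¹+1} |S|² = M² ∑ log² p`
  have hmeas := measurableSet_minorArcs P Q
  have hI1 : ∫ α in minorArcs P Q, ‖expSum P X α ^ 2‖ ^ 2 ≤
      ∫ α in minorArcs P Q, M ^ 2 * ‖expSum P X α‖ ^ 2 := by
    refine setIntegral_mono_on ?_ ?_ hmeas fun α hα => ?_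
    · exact ((Continuous.integrableOn_Icc (by fun_prop)).mono_set hsub)
    · exact ((Continuous.integrableOn_Icc (by fun_prop)).mono_set hsub)
    · have h := hSle α hα
      have h0 : 0 ≤ ‖expSum P X α‖ := norm_nonneg _
      rw [norm_pow, ← pow_mul, show 2 * 2 = 4 by rfl]
      nlinarith [pow_le_pow_left₀ h0 h 2, sq_nonneg ‖expSum P X α‖]
  have hI2 : ∫ α in minorArcs P Q, M ^ 2 * ‖expSum P X α‖ ^ 2 ≤
      M ^ 2 * ∑ p ∈ primeWindow P X, Real.log p ^ 2 := by
    rw [integral_const_mul, ← integral_norm_expSum_sq P X Q⁻¹,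
      intervalIntegral.integral_of_le (by linarith)]
    refine mul_le_mul_of_nonneg_left (setIntegral_mono_set ?_ ?_ ?_) (sq_nonneg _)
    · exact (Continuous.integrableOn_Icc (by fun_prop)).mono_set Set.Ioc_subset_Icc_self
    · exact Filter.Eventually.of_forall fun α => sq_nonneg _
    · exact (show minorArcs P Q ≤ Set.Icc Q⁻¹ (Q⁻¹ + 1) from hsub).eventuallyLE.trans
        Ioc_ae_eq_Icc.symm.le
  have hI3 : M ^ 2 * ∑ p ∈ primeWindow P X, Real.log p ^ 2 ≤
      M ^ 2 * (Real.log 4 * X * Real.log X) :=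
    mul_le_mul_of_nonneg_left (sum_primeWindow_log_sq_le hX1) (sq_nonneg _)
  have hlog : Real.log X ^ 9 ≤ Real.log X ^ 35 := pow_le_pow_right₀ hlogX1 (by norm_num)
  calc ∑ n ∈ Finset.Icc 1 ⌊X⌋₊, ‖minorArcIntegral P Q X n‖ ^ 2
      ≤ ∫ α in minorArcs P Q, ‖expSum P X α ^ 2‖ ^ 2 := hB
    _ ≤ M ^ 2 * (Real.log 4 * X * Real.log X) := hI1.trans (hI2.trans hI3)
    _ = Real.log 4 * C₁ ^ 2 * X ^ 3 * P⁻¹ * Real.log X ^ 9 := by rw [hPu, hM]; ring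
    _ ≤ Real.log 4 * C₁ ^ 2 * X ^ 3 * P⁻¹ * Real.log X ^ 35 := by gcongr


end Literature.NumberTheory.Sieve.MontgomeryVaughan1975

namespace Literature.NumberTheory.Sieve

open MontgomeryVaughan1975

/-- Montgomery–Vaughan 1975, Theorem 1, from Vinogradov's estimate (Lemma 3.1, Nathanson Thm 8.5)
and the major-arc lower bound (8.3): the minor-arc input (3.2) of
`goldbachExceptionalCount_isBigO_rpow_of_montgomeryVaughan` is now discharged by
`minorArc_meanSquare_of_vinogradov`. [cite: MontgomeryVaughanActa1975, Theorem 1 and §3, §8] -/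
theorem goldbachExceptionalCount_isBigO_rpow_of_mv83 (hV : vinogradov_expSum_bound)
    (h83 : majorArc_lowerBound) : goldbachExceptionalCount_isBigO_rpow :=
  goldbachExceptionalCount_isBigO_rpow_of_montgomeryVaughan (minorArc_meanSquare_of_vinogradov hV)
    h83

end Literature.NumberTheory.Sieve
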